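import Summits.Ventures.CertifiedManyBodySolver.Observables.SourcedRowsThermodynamicLimit
import Summits.Ventures.CertifiedManyBodySolver.Observables.PinningFieldStairEnergyDensity
import Literature.MathematicalPhysics.QuantumLattice.InfVolFermionStateWeakLimits
import HarnessLib

/-!
# Hellmann–Feynman chords fed by certificate ROWS on arbitrary side progressions: the two-sided response
# node for translation-invariant states, for infinite-volume ground states (mean-energy minimisers), and for
# the torus stair

HONEST FRAMING: finite-field RESPONSE floors/ceilings (certified once the two input rows are); never an order
parameter, never a phase word, no `h → 0` content; not a superconductivity verdict; every number certified or
labelled float. Nothing here is a number: soundness edges only.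

Companion of `Observables/SourcedRowsThermodynamicLimit.lean` (hubbard-cq-obsth-2: rows ⇒ `e_src`, chord floors on
TORUS-LIMIT ground states) and `Observables/PinningFieldStairEnergyDensity.lean` (hubbard-cq-obsth-3: unconditional stair
brackets from `e_src`, grand-canonical `μ`-floor forms with `q = 1` rows). Cell hubbard-cq, seat hubbard-cq-obsth-3, row
«Hellmann–Feynman bracket → m_d(h) two-sided node»; lead ASSIGN 2026-08-26T22:23:43Z (P3 premise-free GC floor leaves:
the torus-limit / TI grand-canonical / stair forms).

The inputs are obsth-1's uniform cells (`Rows/SourcedTorusRows.lean`)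
`SourcedEnergyLowerRow tp U μ h₁ q L₀ e` (`e·L² ≤ E₀(A_L(tp,U,μ,h₁))` for `L ≥ L₀`, `q ∣ L`) and
`SourcedEnergyUpperRow tp U μ h q' L₀' e'` (`E₀(A_L(tp,U,μ,h)) ≤ e'·L²` for `L ≥ L₀'`, `q' ∣ L`) on ARBITRARY, possibly
different, side progressions — e.g. a translation-invariant SDP window floor (`q = 1`, pilot job D's `G_μ` at `h₁ = 0`)
and an open-cluster tiling cap (`q' = 12`, `Upper/DWaveSourceOpenClusterCap.lean`). Both are bounds on the ONE
thermodynamic-limit sourced energy density `e_src(tp,U,μ,·)` (obsth-2), which is the infimum of the sourced mean energy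
`E^{μ}_h(ω) = ω.meanEnergy (hubbardTTPrimeSourcedInteraction 1 tp U μ ĝ_d h) 1` over translation-invariant states
(`dWaveSourceEnergyDensityTT'_eq_tiGroundEnergyDensity`), so Griffiths' chord inequality gives, with `m(ω) = Re ω(P₀^d)`
(`P₀^d = localPairAt ({0} ∪ unitSteps) dWaveFormFactor 0`, `e_{P_d}(ω) = 2 m(ω)`):

* §1 EVERY translation-invariant `ω` whose OWN sourced energy at `(μ,h)` is `≤ u`: a floor cell at `h₁ < h` gives
  `(e − u)/(2(h − h₁)) ≤ m(ω)` (`SourcedEnergyLowerRow.chordFloor_of_sourced_le`; no density, no `U ≥ 0` hypothesis —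
  the row IS a bound on every TI state's sourced energy, `SourcedEnergyLowerRow.le_meanEnergy_sourced`);
* §2 EVERY infinite-volume ground state at `(μ,h)` = translation-invariant mean-energy MINIMISER of the sourced
  interaction (Bratteli–Kishimoto–Robinson; they exist, `FermionInteraction.exists_isMeanEnergyMinimiser`, and contain
  every torus-limit ground state, `IsTorusLimitOf.isMeanEnergyMinimiser_sourced`): floor cell at `h₁ < h` + ceiling cell
  at `h` ⇒ `(e − e')/(2(h − h₁)) ≤ m(ω)` (`…chordFloor_isMeanEnergyMinimiser`); ceiling cell at `h` + floor cell at
  `h₂ > h` ⇒ `m(ω) ≤ (e' − e₂)/(2(h₂ − h))` (`SourcedEnergyUpperRow.chordCeiling_isMeanEnergyMinimiser`); both ⇒ the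
  two-sided node (`…_mem_Icc_isMeanEnergyMinimiser`);
* §3 the torus STAIR along ALL sides: `(e − e')/(2(h − h₁)) ≤ liminf_L m_{L+1}(tp,U,μ;h)` and
  `limsup_L m_{L+1} ≤ (e' − e₂)/(2(h₂ − h))` (`…chordFloor_liminf`, `…chordCeiling_limsup`) — a cap certified only
  along `12 ∣ L` still floors the stair along every side, through `e_src`;
* §4 SLOT forms with a rational response slot `m` and the decidable side condition `m·2(h − h₁) ≤ e − e'` (the shape
  the literal Certificates leaves instantiate by `norm_num`/`nlinarith`), for §2/§3 and for obsth-2's torus-limit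
  ground-state chord `SourcedEnergyLowerRow.chordFloor_torusLimit`.

References: R. B. Griffiths, J. Math. Phys. 5 (1964) 1215 / Phys. Rev. 152 (1966) 240 §II (concavity chords);
T. Koma, H. Tasaki, J. Stat. Phys. 76 (1994) 745, §1 (the sourced Hamiltonian, response vs. order);
O. Bratteli, A. Kishimoto, D. W. Robinson, Commun. Math. Phys. 64 (1978) 41, Thm. 2 (TI ground states = mean-energy
minimisers); D. Ruelle, *Statistical Mechanics* (1969) §3.4. No definition, no named fact, no `sorry`; zero compute.
-/

noncomputable section

namespace Summit.Ventures.CertifiedManyBodySolver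

open Literature.MathematicalPhysics.QuantumLattice Literature.MathematicalPhysics.QuantumLattice.ThermodynamicLimit
open Literature.Probability.LatticeModels HubbardWave0 InfVolFermionState _root_.Filter _root_.Matrix
open Summit.Ventures.CertifiedManyBodySolver.Observables
open scoped _root_.Topology

variable {tp U μ h : ℝ} {e e' e₂ : ℚ} {q q' q₂ L₀ L₀' L₀₂ : ℕ}

/-! ## §1  Every translation-invariant state: floor cell + the state's own sourced energy -/

section EveryState

variable {ω : InfVolFermionState 2}

/-- **Chord FLOOR for every translation-invariant state, row-fed.** A floor cell `e` at a field `h₁ < h`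
(any progression `q ≥ 1`) and a translation-invariant `ω` whose own sourced mean energy at `(μ, h)` is `≤ u` give
`(e − u)/(2(h − h₁)) ≤ Re ω(P₀^d)`. No density and no sign-of-`U` hypothesis: the cell bounds the sourced energy of
EVERY translation-invariant state (`SourcedEnergyLowerRow.le_meanEnergy_sourced`), then Griffiths' chord
`div_le_pairAmplitude_of_bounds`. [cite: Griffiths1966, §II] [cite: KomaTasaki1994, §1] -/
theorem SourcedEnergyLowerRow.chordFloor_of_sourced_le {h₁ : ℝ} (hlt : h₁ < h)
    (hlo : SourcedEnergyLowerRow tp U μ h₁ q L₀ e) (hq : 0 < q) (hω : ω.IsTranslationInvariant) {u : ℝ}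
    (hu : ω.meanEnergy (hubbardTTPrimeSourcedInteraction 1 tp U μ dWaveFormFactor h) 1 ≤ u) :
    (((e : ℚ) : ℝ) - u) / (2 * (h - h₁)) ≤
      (ω.expect (pairRegion (insert (0 : Site 2) unitSteps) 0)
        (localPairAt (insert 0 unitSteps) dWaveFormFactor 0)).re := by
  have hδ : 0 < h - h₁ := sub_pos.2 hlt
  have hlo' : ((e : ℚ) : ℝ) ≤ ω.meanEnergy (hubbardTTPrimeSourcedInteraction 1 tp U μ dWaveFormFactor (h - (h - h₁))) 1 := by
    rw [show h - (h - h₁) = h₁ by ring]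
    exact hlo.le_meanEnergy_sourced hq hω
  have h1 := ω.div_le_pairAmplitude_of_bounds hδ hlo' hu
  rw [meanEnergy_pairSourceInteraction_dWave_eq] at h1
  rw [div_le_iff₀ (by positivity)]
  rw [div_le_iff₀ hδ] at h1
  linarith

/-- **Chord CEILING for every translation-invariant state, row-fed**: a floor cell `e₂` at a LARGER field `h₂ > h`
and the state's own sourced energy at `(μ,h)` bounded BELOW, `u ≤ E^{μ}_h(ω)`, give `Re ω(P₀^d) ≤ (E − e₂)/(2(h₂ − h))`
for every `E ≥ E^{μ}_h(ω)` … stated with the natural datum: `lo ≤ E^{μ}_{h₂}(ω)` from the cell and `E^{μ}_h(ω) ≤ hi`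
gives `Re ω(P₀^d) ≤ (hi − e₂)/(2(h₂ − h))`. A ceiling; never speaks to presence. [cite: Griffiths1966, §II] -/
theorem SourcedEnergyLowerRow.chordCeiling_of_sourced_le {h₂ : ℝ} (hlt : h < h₂)
    (hlo : SourcedEnergyLowerRow tp U μ h₂ q L₀ e₂) (hq : 0 < q) (hω : ω.IsTranslationInvariant) {hi : ℝ}
    (hhi : ω.meanEnergy (hubbardTTPrimeSourcedInteraction 1 tp U μ dWaveFormFactor h) 1 ≤ hi) :
    (ω.expect (pairRegion (insert (0 : Site 2) unitSteps) 0)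
        (localPairAt (insert 0 unitSteps) dWaveFormFactor 0)).re ≤
      (hi - ((e₂ : ℚ) : ℝ)) / (2 * (h₂ - h)) := by
  have hδ : 0 < h₂ - h := sub_pos.2 hlt
  have hlo' : ((e₂ : ℚ) : ℝ) ≤ ω.meanEnergy (hubbardTTPrimeSourcedInteraction 1 tp U μ dWaveFormFactor (h + (h₂ - h))) 1 := by
    rw [show h + (h₂ - h) = h₂ by ring]
    exact hlo.le_meanEnergy_sourced hq hω
  have h1 := ω.pairAmplitude_le_div_of_bounds hδ hlo' hhi
  rw [meanEnergy_pairSourceInteraction_dWave_eq] at h1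
  rw [le_div_iff₀ (by positivity)]
  rw [le_div_iff₀ hδ] at h1
  linarith

end EveryState

/-! ## §2  Infinite-volume ground states = translation-invariant mean-energy minimisers of the sourced interaction -/

section Minimiser

variable {ω : InfVolFermionState 2}

/-- The sourced mean energy of a MINIMISER at `(tp,U,μ,h)` is the torus-limit energy density `e_src(tp,U,μ,h)`
(`IsMeanEnergyMinimiser.meanEnergy_eq` + `dWaveSourceEnergyDensityTT'_eq_tiGroundEnergyDensity`).
[cite: BratteliKishimotoRobinson1978, Thm. 2] -/
theorem meanEnergy_sourced_eq_dWaveSourceEnergyDensityTT'_of_isMeanEnergyMinimiser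
    (hmin : ω.IsMeanEnergyMinimiser (hubbardTTPrimeSourcedInteraction 1 tp U μ dWaveFormFactor h) 1) :
    ω.meanEnergy (hubbardTTPrimeSourcedInteraction 1 tp U μ dWaveFormFactor h) 1 = dWaveSourceEnergyDensityTT' tp U μ h := by
  rw [hmin.meanEnergy_eq, dWaveSourceEnergyDensityTT'_eq_tiGroundEnergyDensity]

/-- A ceiling cell caps the sourced mean energy of every minimiser: `E^{μ}_h(ω) = e_src(h) ≤ e'`.
[cite: BratteliKishimotoRobinson1978, Thm. 2] -/
theorem SourcedEnergyUpperRow.meanEnergy_sourced_le_of_isMeanEnergyMinimiser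
    (hhi : SourcedEnergyUpperRow tp U μ h q' L₀' e') (hq' : 0 < q')
    (hmin : ω.IsMeanEnergyMinimiser (hubbardTTPrimeSourcedInteraction 1 tp U μ dWaveFormFactor h) 1) :
    ω.meanEnergy (hubbardTTPrimeSourcedInteraction 1 tp U μ dWaveFormFactor h) 1 ≤ ((e' : ℚ) : ℝ) := by
  rw [meanEnergy_sourced_eq_dWaveSourceEnergyDensityTT'_of_isMeanEnergyMinimiser hmin]
  exact hhi.dWaveSourceEnergyDensityTT'_le hq'

/-- **Chord FLOOR for every infinite-volume ground state at `(μ,h)`, from two cells on arbitrary progressions.**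
A floor cell `e` at `h₁ < h` (progression `q`) and a ceiling cell `e'` at the field `h` (progression `q'`) give
`(e − e')/(2(h − h₁)) ≤ Re ω(P₀^d)` for every translation-invariant mean-energy minimiser `ω` of the sourced
interaction at `(tp,U,μ,h)`. With `h₁ = 0`, `q = 1` (a source-free grand-canonical window floor) and `q' = 12` (a `4 × 3`
cluster tiling cap) this is the premise-free GC chord floor on the whole grand-canonical ground-state class.
[cite: Griffiths1966, §II] [cite: BratteliKishimotoRobinson1978, Thm. 2] -/
theorem SourcedEnergyLowerRow.chordFloor_isMeanEnergyMinimiser {h₁ : ℝ} (hlt : h₁ < h)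
    (hlo : SourcedEnergyLowerRow tp U μ h₁ q L₀ e) (hq : 0 < q)
    (hhi : SourcedEnergyUpperRow tp U μ h q' L₀' e') (hq' : 0 < q')
    (hmin : ω.IsMeanEnergyMinimiser (hubbardTTPrimeSourcedInteraction 1 tp U μ dWaveFormFactor h) 1) :
    (((e : ℚ) : ℝ) - ((e' : ℚ) : ℝ)) / (2 * (h - h₁)) ≤
      (ω.expect (pairRegion (insert (0 : Site 2) unitSteps) 0)
        (localPairAt (insert 0 unitSteps) dWaveFormFactor 0)).re :=
  hlo.chordFloor_of_sourced_le hlt hq hmin.1 (hhi.meanEnergy_sourced_le_of_isMeanEnergyMinimiser hq' hmin)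

/-- **Chord CEILING for every infinite-volume ground state at `(μ,h)`**: a ceiling cell `e'` at `h` (progression `q'`)
and a floor cell `e₂` at a larger field `h₂ > h` (progression `q₂`) give `Re ω(P₀^d) ≤ (e' − e₂)/(2(h₂ − h))` for every
translation-invariant mean-energy minimiser `ω` at `(tp,U,μ,h)`. A ceiling; never speaks to presence.
[cite: Griffiths1966, §II] [cite: BratteliKishimotoRobinson1978, Thm. 2] -/
theorem SourcedEnergyUpperRow.chordCeiling_isMeanEnergyMinimiser
    (hhi : SourcedEnergyUpperRow tp U μ h q' L₀' e') (hq' : 0 < q') {h₂ : ℝ} (hlt : h < h₂)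
    (hlo : SourcedEnergyLowerRow tp U μ h₂ q₂ L₀₂ e₂) (hq₂ : 0 < q₂)
    (hmin : ω.IsMeanEnergyMinimiser (hubbardTTPrimeSourcedInteraction 1 tp U μ dWaveFormFactor h) 1) :
    (ω.expect (pairRegion (insert (0 : Site 2) unitSteps) 0)
        (localPairAt (insert 0 unitSteps) dWaveFormFactor 0)).re ≤
      (((e' : ℚ) : ℝ) - ((e₂ : ℚ) : ℝ)) / (2 * (h₂ - h)) :=
  hlo.chordCeiling_of_sourced_le hlt hq₂ hmin.1 (hhi.meanEnergy_sourced_le_of_isMeanEnergyMinimiser hq' hmin)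

/-- **The two-sided response node on the infinite-volume ground-state class.** Floor cell at `h₁ < h`, ceiling cell
AT `h`, floor cell at `h₂ > h` (three arbitrary progressions) bracket `Re ω(P₀^d)` for every translation-invariant
mean-energy minimiser `ω` at `(tp,U,μ,h)`:
`(e − e')/(2(h − h₁)) ≤ Re ω(P₀^d) ≤ (e' − e₂)/(2(h₂ − h))`. [cite: Griffiths1966, §II] [cite: KomaTasaki1994, §1] -/
theorem SourcedEnergyLowerRow.re_expect_localPairAt_mem_Icc_isMeanEnergyMinimiser {h₁ h₂ : ℝ} (hlt₁ : h₁ < h)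
    (hlt₂ : h < h₂) (hlo : SourcedEnergyLowerRow tp U μ h₁ q L₀ e) (hq : 0 < q)
    (hhi : SourcedEnergyUpperRow tp U μ h q' L₀' e') (hq' : 0 < q')
    (hlo₂ : SourcedEnergyLowerRow tp U μ h₂ q₂ L₀₂ e₂) (hq₂ : 0 < q₂)
    (hmin : ω.IsMeanEnergyMinimiser (hubbardTTPrimeSourcedInteraction 1 tp U μ dWaveFormFactor h) 1) :
    (ω.expect (pairRegion (insert (0 : Site 2) unitSteps) 0)
        (localPairAt (insert 0 unitSteps) dWaveFormFactor 0)).re ∈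
      Set.Icc ((((e : ℚ) : ℝ) - ((e' : ℚ) : ℝ)) / (2 * (h - h₁))) ((((e' : ℚ) : ℝ) - ((e₂ : ℚ) : ℝ)) / (2 * (h₂ - h))) :=
  ⟨hlo.chordFloor_isMeanEnergyMinimiser hlt₁ hq hhi hq' hmin,
    hhi.chordCeiling_isMeanEnergyMinimiser hq' hlt₂ hlo₂ hq₂ hmin⟩

/-- NON-VACUITY: infinite-volume ground states of the sourced interaction exist at every `(tp,U,μ,h)` (weak-⋆
compactness, `FermionInteraction.exists_isMeanEnergyMinimiser`), so the floor of
`SourcedEnergyLowerRow.chordFloor_isMeanEnergyMinimiser` is attained by at least one state: two cells give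
`∃ ω minimiser ∧ ∀ ω minimiser, (e − e')/(2(h − h₁)) ≤ Re ω(P₀^d)`. [cite: BratteliKishimotoRobinson1978, Thm. 2] -/
theorem SourcedEnergyLowerRow.exists_and_forall_chordFloor_isMeanEnergyMinimiser {h₁ : ℝ} (hlt : h₁ < h)
    (hlo : SourcedEnergyLowerRow tp U μ h₁ q L₀ e) (hq : 0 < q)
    (hhi : SourcedEnergyUpperRow tp U μ h q' L₀' e') (hq' : 0 < q') :
    (∃ ω : InfVolFermionState 2, ω.IsMeanEnergyMinimiser (hubbardTTPrimeSourcedInteraction 1 tp U μ dWaveFormFactor h) 1) ∧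
      ∀ ω : InfVolFermionState 2,
        ω.IsMeanEnergyMinimiser (hubbardTTPrimeSourcedInteraction 1 tp U μ dWaveFormFactor h) 1 →
          (((e : ℚ) : ℝ) - ((e' : ℚ) : ℝ)) / (2 * (h - h₁)) ≤
            (ω.expect (pairRegion (insert (0 : Site 2) unitSteps) 0)
              (localPairAt (insert 0 unitSteps) dWaveFormFactor 0)).re :=
  ⟨(hubbardTTPrimeSourcedInteraction 1 tp U μ dWaveFormFactor h).exists_isMeanEnergyMinimiser 1,
    fun _ hmin => hlo.chordFloor_isMeanEnergyMinimiser hlt hq hhi hq' hmin⟩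

end Minimiser

/-! ## §3  The torus stair along all sides -/

section Stair

/-- **Stair FLOOR from two cells on arbitrary progressions**: a floor cell `e` at `h₁ < h` (`q ≥ 1`) and a ceiling cell
`e'` at `h` (`q' ≥ 1`) give `(e − e')/(2(h − h₁)) ≤ liminf_L m_{L+1}(tp,U,μ;h)` (`m_L = dWaveSourceDensityTT' L tp U μ h`,
the torus response of the tracial ground state, ALL sides `L + 1`). A cap certified along `12 ∣ L` only still bounds
`e_src(h)`, and the stair bracket `slope_energyDensity_le_liminf_dWaveSourceDensityTT'` is unconditional.
[cite: KomaTasaki1994, §1] -/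
theorem SourcedEnergyLowerRow.chordFloor_liminf {h₁ : ℝ} (hlt : h₁ < h)
    (hlo : SourcedEnergyLowerRow tp U μ h₁ q L₀ e) (hq : 0 < q)
    (hhi : SourcedEnergyUpperRow tp U μ h q' L₀' e') (hq' : 0 < q') :
    (((e : ℚ) : ℝ) - ((e' : ℚ) : ℝ)) / (2 * (h - h₁)) ≤
      liminf (fun L : ℕ => dWaveSourceDensityTT' (L + 1) tp U μ h) atTop := by
  have hδ : 0 < h - h₁ := sub_pos.2 hlt
  have h1 := hlo.le_dWaveSourceEnergyDensityTT' hq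
  have h2 := hhi.dWaveSourceEnergyDensityTT'_le hq'
  have h3 : (((e : ℚ) : ℝ) - ((e' : ℚ) : ℝ)) / (2 * (h - h₁)) ≤
      (dWaveSourceEnergyDensityTT' tp U μ h₁ - dWaveSourceEnergyDensityTT' tp U μ h) / (2 * (h - h₁)) :=
    div_le_div_of_nonneg_right (by linarith) (by positivity)
  exact h3.trans (slope_energyDensity_le_liminf_dWaveSourceDensityTT' tp U μ hlt)

/-- **Stair CEILING from two cells**: a ceiling cell `e'` at `h` and a floor cell `e₂` at `h₂ > h` give
`limsup_L m_{L+1}(tp,U,μ;h) ≤ (e' − e₂)/(2(h₂ − h))`. A ceiling; never speaks to presence. [cite: KomaTasaki1994, §1] -/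
theorem SourcedEnergyUpperRow.chordCeiling_limsup (hhi : SourcedEnergyUpperRow tp U μ h q' L₀' e') (hq' : 0 < q')
    {h₂ : ℝ} (hlt : h < h₂) (hlo : SourcedEnergyLowerRow tp U μ h₂ q₂ L₀₂ e₂) (hq₂ : 0 < q₂) :
    limsup (fun L : ℕ => dWaveSourceDensityTT' (L + 1) tp U μ h) atTop ≤
      (((e' : ℚ) : ℝ) - ((e₂ : ℚ) : ℝ)) / (2 * (h₂ - h)) := by
  have hδ : 0 < h₂ - h := sub_pos.2 hlt
  have h1 := hlo.le_dWaveSourceEnergyDensityTT' hq₂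
  have h2 := hhi.dWaveSourceEnergyDensityTT'_le hq'
  have h3 : (dWaveSourceEnergyDensityTT' tp U μ h - dWaveSourceEnergyDensityTT' tp U μ h₂) / (2 * (h₂ - h)) ≤
      (((e' : ℚ) : ℝ) - ((e₂ : ℚ) : ℝ)) / (2 * (h₂ - h)) :=
    div_le_div_of_nonneg_right (by linarith) (by positivity)
  exact (limsup_dWaveSourceDensityTT'_le_slope_energyDensity tp U μ hlt).trans h3

end Stair

/-! ## §4  Slot forms: a rational response slot `m` with the decidable side condition `m·2(h − h₁) ≤ e − e'` -/

section Slot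

variable {ω : InfVolFermionState 2} {ψ : ∀ L, Fock (Orb (FermionTorus 2 L))} {Ls : ℕ → ℕ}

/-- Slot arithmetic: `m·2(h − h₁) ≤ e − e'` with `h₁ < h` is `m ≤ (e − e')/(2(h − h₁))`. [folklore] -/
theorem slot_le_chord {h₁ : ℝ} (hlt : h₁ < h) {m : ℚ} (hm : ((m : ℚ) : ℝ) * (2 * (h - h₁)) ≤ ((e : ℚ) : ℝ) - e') :
    ((m : ℚ) : ℝ) ≤ (((e : ℚ) : ℝ) - ((e' : ℚ) : ℝ)) / (2 * (h - h₁)) := by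
  rw [le_div_iff₀ (by linarith)]
  exact hm

/-- **Slot form, infinite-volume ground states**: cells `e` at `h₁ < h`, `e'` at `h`, and a rational slot `m` with
`m·2(h − h₁) ≤ e − e'` give `m ≤ Re ω(P₀^d)` for every translation-invariant mean-energy minimiser at `(tp,U,μ,h)`.
[cite: Griffiths1966, §II] -/
theorem SourcedEnergyLowerRow.responseFloor_isMeanEnergyMinimiser_of_slot {h₁ : ℝ} (hlt : h₁ < h)
    (hlo : SourcedEnergyLowerRow tp U μ h₁ q L₀ e) (hq : 0 < q)
    (hhi : SourcedEnergyUpperRow tp U μ h q' L₀' e') (hq' : 0 < q') {m : ℚ}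
    (hm : ((m : ℚ) : ℝ) * (2 * (h - h₁)) ≤ ((e : ℚ) : ℝ) - e')
    (hmin : ω.IsMeanEnergyMinimiser (hubbardTTPrimeSourcedInteraction 1 tp U μ dWaveFormFactor h) 1) :
    ((m : ℚ) : ℝ) ≤
      (ω.expect (pairRegion (insert (0 : Site 2) unitSteps) 0)
        (localPairAt (insert 0 unitSteps) dWaveFormFactor 0)).re :=
  (slot_le_chord hlt hm).trans (hlo.chordFloor_isMeanEnergyMinimiser hlt hq hhi hq' hmin)

/-- **Slot form, torus-limit ground states** (obsth-2's `SourcedEnergyLowerRow.chordFloor_torusLimit` with a rational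
slot): for every torus limit `ω` of unit ground-state vectors of `A_L(tp,U,μ,h)` along a divergent side sequence,
`m ≤ Re ω(P₀^d)`. [cite: KomaTasaki1994, §1] -/
theorem SourcedEnergyLowerRow.responseFloor_torusLimit_of_slot [hL0 : ∀ j, NeZero (Ls j)]
    (hω : ω.IsTorusLimitOf ψ Ls) (hLs : Tendsto Ls atTop atTop) (hψ : ∀ j, star (ψ (Ls j)) ⬝ᵥ ψ (Ls j) = 1)
    (hgs : ∀ j, dWaveSourceTorusTT' (Ls j) tp U μ h *ᵥ ψ (Ls j) =
      ((Matrix.groundEnergy (dWaveSourceTorusTT' (Ls j) tp U μ h) : ℝ) : ℂ) • ψ (Ls j))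
    {h₁ : ℝ} (hlt : h₁ < h) (hlo : SourcedEnergyLowerRow tp U μ h₁ q L₀ e) (hq : 0 < q)
    (hhi : SourcedEnergyUpperRow tp U μ h q' L₀' e') (hq' : 0 < q') {m : ℚ}
    (hm : ((m : ℚ) : ℝ) * (2 * (h - h₁)) ≤ ((e : ℚ) : ℝ) - e') :
    ((m : ℚ) : ℝ) ≤
      (ω.expect (pairRegion (insert (0 : Site 2) unitSteps) 0)
        (localPairAt (insert 0 unitSteps) dWaveFormFactor 0)).re :=
  (slot_le_chord hlt hm).trans (hlo.chordFloor_torusLimit hω hLs hψ hgs hlt hq hhi hq')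

/-- **Slot form, stair**: `m ≤ liminf_L m_{L+1}(tp,U,μ;h)`. [cite: KomaTasaki1994, §1] -/
theorem SourcedEnergyLowerRow.responseFloor_liminf_of_slot {h₁ : ℝ} (hlt : h₁ < h)
    (hlo : SourcedEnergyLowerRow tp U μ h₁ q L₀ e) (hq : 0 < q)
    (hhi : SourcedEnergyUpperRow tp U μ h q' L₀' e') (hq' : 0 < q') {m : ℚ}
    (hm : ((m : ℚ) : ℝ) * (2 * (h - h₁)) ≤ ((e : ℚ) : ℝ) - e') :
    ((m : ℚ) : ℝ) ≤ liminf (fun L : ℕ => dWaveSourceDensityTT' (L + 1) tp U μ h) atTop :=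
  (slot_le_chord hlt hm).trans (hlo.chordFloor_liminf hlt hq hhi hq')

/-- **Slot form, every translation-invariant state with a certified sourced-energy cap `u`** (e.g. a state of the
grand-canonical class whose own `E^{μ}_h ≤ u` is known): `m·2(h − h₁) ≤ e − u` gives `m ≤ Re ω(P₀^d)`.
[cite: Griffiths1966, §II] -/
theorem SourcedEnergyLowerRow.responseFloor_of_sourced_le_of_slot {h₁ : ℝ} (hlt : h₁ < h)
    (hlo : SourcedEnergyLowerRow tp U μ h₁ q L₀ e) (hq : 0 < q) (hω : ω.IsTranslationInvariant) {u : ℚ}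
    (hu : ω.meanEnergy (hubbardTTPrimeSourcedInteraction 1 tp U μ dWaveFormFactor h) 1 ≤ ((u : ℚ) : ℝ)) {m : ℚ}
    (hm : ((m : ℚ) : ℝ) * (2 * (h - h₁)) ≤ ((e : ℚ) : ℝ) - u) :
    ((m : ℚ) : ℝ) ≤
      (ω.expect (pairRegion (insert (0 : Site 2) unitSteps) 0)
        (localPairAt (insert 0 unitSteps) dWaveFormFactor 0)).re :=
  (slot_le_chord hlt hm).trans (hlo.chordFloor_of_sourced_le hlt hq hω hu)

end Slot

/-! ## §5  Floor fed by a thermodynamic-limit number instead of a cell: `c ≤ e_src(tp,U,μ,h₁)` (e.g. a `μ`-floor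
`c ≤ p(1,tp,U,μ) = e_src(tp,U,μ,0)` certified by the all-density TANGENT of a canonical window certificate,
`gcFloor_of_tangent`) + a ceiling CELL at `h` — appended 2026-08-26 (lead ASSIGN 22:23:43Z, route P2); torus-limit ground
states: obsth-2's `IsTorusLimitOf.re_expect_localPairAt_ge_of_energyDensity_bounds` takes the same two inputs directly -/

section TLFloor

variable {ω : InfVolFermionState 2}

/-- **A canonical TANGENT is a floor on `e_src(tp,U,μ,0)`.** For `U ≥ 0`: `∀ m ∈ (0,2), ℓ + μ(m − n) ≤ e(1,tp,U,m)`
(the all-density reading of a canonical window certificate at density `n` with filling multiplier `μ`) gives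
`ℓ − μn ≤ e_src(tp,U,μ,0)` (`gcFloor_of_tangent`, `e_src(·,0) = p(μ)`). [cite: Ruelle1969, §3.4] -/
theorem energyDensity_zero_floor_of_tangent {tp U μ ℓ n : ℝ} (hU : 0 ≤ U)
    (htan : ∀ m : ℝ, 0 < m → m < 2 → ℓ + μ * (m - n) ≤ energyDensityTT' 1 tp U m) :
    ℓ - μ * n ≤ dWaveSourceEnergyDensityTT' tp U μ 0 := by
  rw [dWaveSourceEnergyDensityTT'_zero_eq_gcEnergyDensityTT' tp hU μ]
  exact gcFloor_of_tangent hU htan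

/-- **Chord FLOOR for every translation-invariant state from a TL floor at `h₁ < h` and the state's own sourced
energy**: `c ≤ e_src(tp,U,μ,h₁)` and `E^{μ}_h(ω) ≤ u` give `(c − u)/(2(h − h₁)) ≤ Re ω(P₀^d)` (no density hypothesis:
`e_src(h₁) ≤ E^{μ}_{h₁}(ω)` for every translation-invariant `ω`). [cite: Griffiths1966, §II] -/
theorem responseFloor_of_energyDensity_le_of_sourced_le {h₁ c u : ℝ} (hlt : h₁ < h)
    (hc : c ≤ dWaveSourceEnergyDensityTT' tp U μ h₁) (hω : ω.IsTranslationInvariant)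
    (hu : ω.meanEnergy (hubbardTTPrimeSourcedInteraction 1 tp U μ dWaveFormFactor h) 1 ≤ u) :
    (c - u) / (2 * (h - h₁)) ≤
      (ω.expect (pairRegion (insert (0 : Site 2) unitSteps) 0)
        (localPairAt (insert 0 unitSteps) dWaveFormFactor 0)).re := by
  have hδ : 0 < h - h₁ := sub_pos.2 hlt
  have hlo' : c ≤ ω.meanEnergy (hubbardTTPrimeSourcedInteraction 1 tp U μ dWaveFormFactor (h - (h - h₁))) 1 := by
    rw [show h - (h - h₁) = h₁ by ring]
    exact hc.trans (dWaveSourceEnergyDensityTT'_le_meanEnergy_sourced tp U μ h₁ hω)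
  have h1 := ω.div_le_pairAmplitude_of_bounds hδ hlo' hu
  rw [meanEnergy_pairSourceInteraction_dWave_eq] at h1
  rw [div_le_iff₀ (by positivity)]
  rw [div_le_iff₀ hδ] at h1
  linarith

/-- **Chord FLOOR for every infinite-volume ground state from a TL floor and a ceiling cell**: `c ≤ e_src(tp,U,μ,h₁)`,
`h₁ < h`, and `SourcedEnergyUpperRow tp U μ h q' L₀' e'` give `(c − e')/(2(h − h₁)) ≤ Re ω(P₀^d)` for every
translation-invariant mean-energy minimiser `ω` at `(tp,U,μ,h)`. [cite: Griffiths1966, §II] [cite: BratteliKishimotoRobinson1978, Thm. 2] -/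
theorem SourcedEnergyUpperRow.chordFloor_isMeanEnergyMinimiser_of_energyDensity_le {h₁ c : ℝ} (hlt : h₁ < h)
    (hc : c ≤ dWaveSourceEnergyDensityTT' tp U μ h₁) (hhi : SourcedEnergyUpperRow tp U μ h q' L₀' e') (hq' : 0 < q')
    (hmin : ω.IsMeanEnergyMinimiser (hubbardTTPrimeSourcedInteraction 1 tp U μ dWaveFormFactor h) 1) :
    (c - ((e' : ℚ) : ℝ)) / (2 * (h - h₁)) ≤
      (ω.expect (pairRegion (insert (0 : Site 2) unitSteps) 0)
        (localPairAt (insert 0 unitSteps) dWaveFormFactor 0)).re :=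
  responseFloor_of_energyDensity_le_of_sourced_le hlt hc hmin.1 (hhi.meanEnergy_sourced_le_of_isMeanEnergyMinimiser hq' hmin)

/-- **Stair FLOOR from a TL floor and a ceiling cell**: `(c − e')/(2(h − h₁)) ≤ liminf_L m_{L+1}(tp,U,μ;h)`.
[cite: KomaTasaki1994, §1] -/
theorem SourcedEnergyUpperRow.chordFloor_liminf_of_energyDensity_le {h₁ c : ℝ} (hlt : h₁ < h)
    (hc : c ≤ dWaveSourceEnergyDensityTT' tp U μ h₁) (hhi : SourcedEnergyUpperRow tp U μ h q' L₀' e') (hq' : 0 < q') :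
    (c - ((e' : ℚ) : ℝ)) / (2 * (h - h₁)) ≤ liminf (fun L : ℕ => dWaveSourceDensityTT' (L + 1) tp U μ h) atTop := by
  have hδ : 0 < h - h₁ := sub_pos.2 hlt
  have h2 := hhi.dWaveSourceEnergyDensityTT'_le hq'
  have h3 : (c - ((e' : ℚ) : ℝ)) / (2 * (h - h₁)) ≤
      (dWaveSourceEnergyDensityTT' tp U μ h₁ - dWaveSourceEnergyDensityTT' tp U μ h) / (2 * (h - h₁)) :=
    div_le_div_of_nonneg_right (by linarith) (by positivity)
  exact h3.trans (slope_energyDensity_le_liminf_dWaveSourceDensityTT' tp U μ hlt)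

/-- Slot arithmetic with a real floor: `m·2(h − h₁) ≤ c − e'` is `m ≤ (c − e')/(2(h − h₁))`. [folklore] -/
theorem slot_le_chord_real {h₁ c : ℝ} (hlt : h₁ < h) {m : ℚ} (hm : ((m : ℚ) : ℝ) * (2 * (h - h₁)) ≤ c - ((e' : ℚ) : ℝ)) :
    ((m : ℚ) : ℝ) ≤ (c - ((e' : ℚ) : ℝ)) / (2 * (h - h₁)) := by
  rw [le_div_iff₀ (by linarith)]
  exact hm

/-- **Slot form, infinite-volume ground states, TL floor**: `m ≤ Re ω(P₀^d)`. [cite: Griffiths1966, §II] -/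
theorem SourcedEnergyUpperRow.responseFloor_isMeanEnergyMinimiser_of_energyDensity_le_of_slot {h₁ c : ℝ}
    (hlt : h₁ < h) (hc : c ≤ dWaveSourceEnergyDensityTT' tp U μ h₁) (hhi : SourcedEnergyUpperRow tp U μ h q' L₀' e')
    (hq' : 0 < q') {m : ℚ} (hm : ((m : ℚ) : ℝ) * (2 * (h - h₁)) ≤ c - ((e' : ℚ) : ℝ))
    (hmin : ω.IsMeanEnergyMinimiser (hubbardTTPrimeSourcedInteraction 1 tp U μ dWaveFormFactor h) 1) :
    ((m : ℚ) : ℝ) ≤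
      (ω.expect (pairRegion (insert (0 : Site 2) unitSteps) 0)
        (localPairAt (insert 0 unitSteps) dWaveFormFactor 0)).re :=
  (slot_le_chord_real hlt hm).trans (hhi.chordFloor_isMeanEnergyMinimiser_of_energyDensity_le hlt hc hq' hmin)

/-- **Slot form, stair, TL floor**: `m ≤ liminf_L m_{L+1}(tp,U,μ;h)`. [cite: KomaTasaki1994, §1] -/
theorem SourcedEnergyUpperRow.responseFloor_liminf_of_energyDensity_le_of_slot {h₁ c : ℝ} (hlt : h₁ < h)
    (hc : c ≤ dWaveSourceEnergyDensityTT' tp U μ h₁) (hhi : SourcedEnergyUpperRow tp U μ h q' L₀' e') (hq' : 0 < q')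
    {m : ℚ} (hm : ((m : ℚ) : ℝ) * (2 * (h - h₁)) ≤ c - ((e' : ℚ) : ℝ)) :
    ((m : ℚ) : ℝ) ≤ liminf (fun L : ℕ => dWaveSourceDensityTT' (L + 1) tp U μ h) atTop :=
  (slot_le_chord_real hlt hm).trans (hhi.chordFloor_liminf_of_energyDensity_le hlt hc hq')

end TLFloor

end Summit.Ventures.CertifiedManyBodySolver

end
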